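import Summits.HodgeConjecture.HodgeConjecture.Theorems.VHCAbelianSchemesRoadLocallyServedAnchorPinned
import Summits.HodgeConjecture.HodgeConjecture.Theorems.Ring2AbelianAllOneTensorWeilClassCarrierDefs
import HarnessLib

/-!
# Road b02 (`VHCAbelianSchemesRoad`, D-0059) — skeleton v3.5.1 of crux `SemiregularSheafRepresentativesTwPrimeAtDiagLocal` (item
# stmt-HodgeConjecture-23176), span stub 2s′: the span statement from CARRIED CLASSES (per anchor, per class), and the two re-cuts of 2s′
# that the L1″ verdict of ring2-b03x gen 7 asks for — «one carried direction + a second carried direction» (LEAD 160's contingency F7: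
# 2a′₀ ∧ 2m′ ⟹ 2s′) and the ∃-keyed anchor predicate under which 2s′ is a THEOREM

research route conditional on HC_CM; not a corollary; Q11.4-sentence-2 already refuted in dim ≥ 3.

THEOREMS ONLY (no definition, no named fact, no sorry; `HC_CM` occurs nowhere; nothing of an existing file is edited). ring2-b03x gen 7
(plate L1″ of director-hodge R11.6 (2) ∕ LEAD 160 START-HERE; memo `L1PP-b03x-g7.md` = evidence on stmt-HodgeConjecture-23176); helper
`--supports stmt-HodgeConjecture-23176`. Door-, degree- and anchor-GENERIC glue over ab-andre-2 g66's `AnchoredSpanAt` (p583871) and the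
served-class map `AbelianAll.carriedClasses 𝒪 n p X θ` («`w` HAS an `𝒪`-datum modulo the `θ`-ray», p-numbered defs file of the André column):

* §1 `anchoredCarrierAt_inter_carriedClasses` (the anchored-carrier statement for `𝔘 ∩ carried` is a tautology); `AnchoredSpanAt.mono`
  (fewer anchors ∕ more admissible directions ∕ fewer classes to serve); `anchoredSpanAt_of_one_carried`, `anchoredSpanAt_of_two_carried`:
  the span statement follows from «every rational `w ∈ 𝔏 Y θ` is `x•u₁ + y•u₂ + z•θᵖ` with `u_j ∈ 𝔘 Y θ` rational AND CARRIED» — g66's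
  `anchoredSpanAt_of_anchoredCarrierAt_pair` with `𝔖_j := 𝔘 ∩ carried`, the witnesses chosen per class instead of per direction set.
* §2 the PINNED `(6,3)` instances: `anchoredSpanAt_served_of_two_carried_served` (any anchor predicate `𝔄`: two carried pinned-served
  classes spanning `𝔖^pin Y θ` modulo `θ³` at every `𝔄`-anchor ⟹ `AnchoredSpanAt 𝒪 6 3 𝔄 𝔖^pin (𝔖^pin + ℂθ³)`); at `𝔄 := 𝔄^pin` this is 2s′
  (`anchoredSpanAt_pinned_of_two_carried_served`); the F7 re-cut `anchoredSpanAt_pinned_of_oneCarried_of_secondCarried`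
  (2a′₀ «at every pinned anchor SOME rational pinned-served class is carried» ∧ 2m′ «at every pinned anchor, one carried pinned-served
  class ⟹ a second one, the two spanning `𝔖^pin` mod `θ³`» ⟹ 2s′ — at `d = 4`: print's `𝓔̄` for `γ₀` and the mover `(ḡ_u)_*𝓔̄`, `u = 2+φ₄`,
  for `γ₁ = i(Ω₁−Ω₂)`, ring2-b03x THEOREM M (a) and THEOREM T of the memo: `adm((ḡ_u)_*𝓔̄) ⟺ adm(𝓔̄)`); and the ∃-KEYED form
  `anchoredSpanAt_pinnedCarriedPair`: with the anchor predicate SHRUNK to «pinned AND two carried pinned-served classes span» the span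
  statement holds OUTRIGHT, so that every content moves to the inhabitation of that predicate (an ∃-statement, the quantifier shape of
  print's claim-fact `Markman2025_secantQuotient_twistedCarrier_onJacobian_pinned`) and to reachability (stub 2r′).
* §3 the same three at the road's primed twisted door `tw C AdmTw′` spelled out (the literal door of the registered stubs).

NOT claimed: that any class is carried anywhere (2a′₀, 2m′, L1″ are HYPOTHESES wherever they occur), any cell, the crux, `HC_AV`, HC.
References: [Bloch1972Semiregularity] Rem. (7.5); [Markman2025SecantWeil] Thm. 1.4.1 (item 4), §1.5, Lemma 9.3.11; [BuchweitzFlenner2003] §5 Thm. 5.1.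
-/

noncomputable section

open CategoryTheory CategoryTheory.Limits AlgebraicGeometry Topology

namespace Summit.HodgeConjecture.HodgeConjecture.Ring2.SemiregularRepresentatives

set_option linter.dupNamespace false -- the cell's namespace repeats the summit name, as in every `Ring2*` file

open Literature.AlgebraicGeometry Literature.AlgebraicGeometry.Motives Literature.AlgebraicGeometry.HodgeTheory
open Literature.AlgebraicTopology.SingularHomology
open Summit.Ventures.HSemireg (ObjClass)
open Summit.HodgeConjecture.HodgeConjecture.Ring2.AbelianAll (carriedClasses)

/-! ## §1 Generic glue: the span statement from carried classes -/

section Generic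

variable {𝒪 : ObjClass} {n p : ℕ} {𝔄 𝔄' : ∀ X : SchemeOver ℂ, complexBetti X 2 → Prop}
  {𝔘 𝔘' 𝔏 𝔏' : ∀ (X : SchemeOver ℂ), complexBetti X 2 → Set (complexBetti X (2 * p))}

/-- **The anchored-carrier statement for the CARRIED members of any direction set is a tautology**:
`AnchoredCarrierAt 𝒪 n p 𝔄 (𝔘 ∩ carriedClasses 𝒪 n p)` (the datum is the membership witness). [cite: Bloch1972Semiregularity, Remark (7.5)] -/
theorem anchoredCarrierAt_inter_carriedClasses :
    AnchoredCarrierAt 𝒪 n p 𝔄 (fun Y θ ↦ 𝔘 Y θ ∩ carriedClasses 𝒪 n p Y θ) :=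
  fun _ _ _ _ hw _ ↦ hw.2

/-- **Monotonicity of the span statement**: FEWER anchors (`𝔄' ≤ 𝔄`), MORE admissible directions (`𝔘 ⊆ 𝔘'`) and FEWER classes to serve
(`𝔏' ⊆ 𝔏`) weaken `AnchoredSpanAt` (formal bookkeeping on its binders). [cite: Bloch1972Semiregularity, Remark (7.5)] -/
theorem AnchoredSpanAt.mono (h : AnchoredSpanAt 𝒪 n p 𝔄 𝔘 𝔏)
    (h𝔄 : ∀ (Y : SchemeOver ℂ) (θ : complexBetti Y 2), 𝔄' Y θ → 𝔄 Y θ)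
    (h𝔘 : ∀ (Y : SchemeOver ℂ) (θ : complexBetti Y 2), 𝔘 Y θ ⊆ 𝔘' Y θ)
    (h𝔏 : ∀ (Y : SchemeOver ℂ) (θ : complexBetti Y 2), 𝔏' Y θ ⊆ 𝔏 Y θ) :
    AnchoredSpanAt 𝒪 n p 𝔄' 𝔘' 𝔏' := by
  intro Y θ hY w hw hwQ
  obtain ⟨k, I, κ, u, a', cp, c, side, a, cθ, hdat, ha, hsum⟩ := h Y θ (h𝔄 Y θ hY) w (h𝔏 Y θ hw) hwQ
  exact ⟨k, I, κ, u, a', cp, c, side, a, cθ,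
    fun i ↦ ⟨(hdat i).1, (hdat i).2.1, h𝔘 Y θ (hdat i).2.2.1, (hdat i).2.2.2⟩, ha, hsum⟩

/-- **ONE carried direction per class gives the span statement** (`k = 1`): if every rational `w ∈ 𝔏 Y θ` at every anchor is
`x•u + z•θᵖ` with `u ∈ 𝔘 Y θ` rational and CARRIED (`u ∈ carriedClasses 𝒪 n p Y θ`), then `AnchoredSpanAt 𝒪 n p 𝔄 𝔘 𝔏`.
[cite: Bloch1972Semiregularity, Remark (7.5)] [cite: Markman2025SecantWeil, Thm. 1.4.1] -/
theorem anchoredSpanAt_of_one_carried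
    (h : ∀ (Y : SchemeOver ℂ) (θ : complexBetti Y 2), 𝔄 Y θ → ∀ w ∈ 𝔏 Y θ, IsRationalClass w →
      ∃ u ∈ 𝔘 Y θ, IsRationalClass u ∧ u ∈ carriedClasses 𝒪 n p Y θ ∧ ∃ x z : ℂ, w = x • u + z • cupPowTwo θ p) :
    AnchoredSpanAt 𝒪 n p 𝔄 𝔘 𝔏 := by
  have h1 : AnchoredSpanAt 𝒪 n p 𝔄 (fun Y θ ↦ 𝔘 Y θ ∩ carriedClasses 𝒪 n p Y θ) 𝔏 :=
    anchoredSpanAt_of_anchoredCarrierAt anchoredCarrierAt_inter_carriedClasses fun Y θ hY w hw hwQ ↦ by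
      obtain ⟨u, hu, huQ, hc, x, z, hw'⟩ := h Y θ hY w hw hwQ
      exact ⟨u, ⟨hu, hc⟩, huQ, x, z, hw'⟩
  exact h1.mono (fun _ _ h ↦ h) (fun _ _ ↦ Set.inter_subset_left) fun _ _ ↦ subset_rfl

/-- **TWO carried directions per class give the span statement** (`k = 2`): if every rational `w ∈ 𝔏 Y θ` at every anchor is
`x•u₁ + y•u₂ + z•θᵖ` with `u₁, u₂ ∈ 𝔘 Y θ` rational and CARRIED, then `AnchoredSpanAt 𝒪 n p 𝔄 𝔘 𝔏` — ab-andre-2 g66's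
`anchoredSpanAt_of_anchoredCarrierAt_pair` at `𝔖₁ = 𝔖₂ := 𝔘 ∩ carried`. At `(6,3)`, `d = 4`: `u₁ = γ₀` (print's `𝓔̄`), `u₂ = γ₁ = i(Ω₁−Ω₂)`
(the mover `(ḡ_u)_*𝓔̄`, `u = 2+φ₄`), ring2-b03x THEOREM M (a). [cite: Markman2025SecantWeil, Thm. 1.4.1 (item 4) and §1.5]
[cite: Bloch1972Semiregularity, Remark (7.5)] -/
theorem anchoredSpanAt_of_two_carried
    (h : ∀ (Y : SchemeOver ℂ) (θ : complexBetti Y 2), 𝔄 Y θ → ∀ w ∈ 𝔏 Y θ, IsRationalClass w →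
      ∃ u₁ ∈ 𝔘 Y θ, ∃ u₂ ∈ 𝔘 Y θ, IsRationalClass u₁ ∧ IsRationalClass u₂ ∧
        u₁ ∈ carriedClasses 𝒪 n p Y θ ∧ u₂ ∈ carriedClasses 𝒪 n p Y θ ∧
        ∃ x y z : ℂ, w = x • u₁ + y • u₂ + z • cupPowTwo θ p) :
    AnchoredSpanAt 𝒪 n p 𝔄 𝔘 𝔏 := by
  have h2 : AnchoredSpanAt 𝒪 n p 𝔄
      (fun Y θ ↦ (𝔘 Y θ ∩ carriedClasses 𝒪 n p Y θ) ∪ (𝔘 Y θ ∩ carriedClasses 𝒪 n p Y θ)) 𝔏 :=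
    anchoredSpanAt_of_anchoredCarrierAt_pair anchoredCarrierAt_inter_carriedClasses anchoredCarrierAt_inter_carriedClasses
      fun Y θ hY w hw hwQ ↦ by
        obtain ⟨u₁, hu₁, u₂, hu₂, hu₁Q, hu₂Q, hc₁, hc₂, x, y, z, hw'⟩ := h Y θ hY w hw hwQ
        exact ⟨u₁, ⟨hu₁, hc₁⟩, u₂, ⟨hu₂, hc₂⟩, hu₁Q, hu₂Q, x, y, z, hw'⟩
  exact h2.mono (fun _ _ h ↦ h) (fun _ _ ↦ Set.union_subset Set.inter_subset_left Set.inter_subset_left)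
    fun _ _ ↦ subset_rfl

end Generic

/-! ## §2 The pinned `(6,3)` instances: 2s′ from two carried pinned-served classes; the F7 re-cut; the ∃-keyed anchor predicate -/

section Pinned

variable {𝒪 : ObjClass} {𝔄 : ∀ X : SchemeOver ℂ, complexBetti X 2 → Prop}

/-- **Two carried pinned-served classes spanning `𝔖^pin` modulo `θ³` at every `𝔄`-anchor give the span statement for
`(𝔄, 𝔖^pin, 𝔖^pin + ℂθ³)`** (any anchor predicate `𝔄`; rationality of the two classes is part of `IsSecantQuotientWeilClassAtPinned`; the class
`w = 0 + z•θ³` is served with `x = y = 0`). [cite: Markman2025SecantWeil, Thm. 1.4.1 (item 4) and §1.5] [cite: Bloch1972Semiregularity, Remark (7.5)] -/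
theorem anchoredSpanAt_served_of_two_carried_served
    (h : ∀ (Y : SchemeOver ℂ) (θ : complexBetti Y 2), 𝔄 Y θ →
      ∃ γ₁ ∈ secantQuotientServedClassesPinned Y θ, ∃ γ₂ ∈ secantQuotientServedClassesPinned Y θ,
        γ₁ ∈ carriedClasses 𝒪 6 3 Y θ ∧ γ₂ ∈ carriedClasses 𝒪 6 3 Y θ ∧
        ∀ γ ∈ secantQuotientServedClassesPinned Y θ, ∃ x y z : ℂ, γ = x • γ₁ + y • γ₂ + z • cupPowTwo θ 3) :
    AnchoredSpanAt 𝒪 6 3 𝔄 (fun Y θ ↦ secantQuotientServedClassesPinned Y θ)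
      (fun Y θ ↦ {w : complexBetti Y (2 * 3) |
        ∃ γ, (γ = 0 ∨ γ ∈ secantQuotientServedClassesPinned Y θ) ∧ ∃ z : ℂ, w = γ + z • cupPowTwo θ 3}) := by
  refine anchoredSpanAt_of_two_carried fun Y θ hY w hw _ ↦ ?_
  obtain ⟨γ₁, hγ₁, γ₂, hγ₂, hc₁, hc₂, hspan⟩ := h Y θ hY
  obtain ⟨γ, hγ, z, hwz⟩ := hw
  refine ⟨γ₁, hγ₁, γ₂, hγ₂, IsSecantQuotientWeilClassAtPinned.isRationalClass hγ₁,
    IsSecantQuotientWeilClassAtPinned.isRationalClass hγ₂, hc₁, hc₂, ?_⟩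
  rcases hγ with h0 | hγS
  · exact ⟨0, 0, z, by simp only [hwz, h0, zero_smul, zero_add]⟩
  · obtain ⟨x, y, z', hγ'⟩ := hspan γ hγS
    exact ⟨x, y, z' + z, by rw [hwz, hγ', add_smul, ← add_assoc]⟩

/-- **2s′ from two carried pinned-served classes at every PINNED anchor** (`𝔄 := 𝔄^pin`): the registered span stub of skeleton v3.5.1
follows from «at every pinned anchor `(Y, θ)` there are `γ₁, γ₂ ∈ 𝔖^pin Y θ`, both CARRIED by `𝒪`-data, with `𝔖^pin Y θ ⊆ ℂγ₁ + ℂγ₂ + ℂθ³`».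
At `d = 4`: `γ₁ = γ₀ ∝ Ω₁+Ω₂` (print's `𝓔̄`), `γ₂ = i(Ω₁−Ω₂)` (the mover `(ḡ_u)_*𝓔̄`), `W_ℚ(Y₄) = ℚγ₀ ⊕ ℚγ₁` (THEOREM M (a)).
[cite: Markman2025SecantWeil, Thm. 1.4.1 (item 4), §1.5 and Lemma 9.3.11] [cite: Bloch1972Semiregularity, Remark (7.5)] -/
theorem anchoredSpanAt_pinned_of_two_carried_served
    (h : ∀ (Y : SchemeOver ℂ) (θ : complexBetti Y 2), secantQuotientAnchorsPinned Y θ →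
      ∃ γ₁ ∈ secantQuotientServedClassesPinned Y θ, ∃ γ₂ ∈ secantQuotientServedClassesPinned Y θ,
        γ₁ ∈ carriedClasses 𝒪 6 3 Y θ ∧ γ₂ ∈ carriedClasses 𝒪 6 3 Y θ ∧
        ∀ γ ∈ secantQuotientServedClassesPinned Y θ, ∃ x y z : ℂ, γ = x • γ₁ + y • γ₂ + z • cupPowTwo θ 3) :
    AnchoredSpanAt 𝒪 6 3 (fun Y θ ↦ secantQuotientAnchorsPinned Y θ) (fun Y θ ↦ secantQuotientServedClassesPinned Y θ)
      (fun Y θ ↦ {w : complexBetti Y (2 * 3) |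
        ∃ γ, (γ = 0 ∨ γ ∈ secantQuotientServedClassesPinned Y θ) ∧ ∃ z : ℂ, w = γ + z • cupPowTwo θ 3}) :=
  anchoredSpanAt_served_of_two_carried_served h

/-- **The F7 re-cut of 2s′ (LEAD 160, J r4 feedback F7): 2a′₀ ∧ 2m′ ⟹ 2s′.** 2a′₀ = «at every pinned anchor SOME pinned-served class is
carried» (print's shape: `𝓔̄` serves `γ₀`; Markman Thm. 1.4.1 ∕ Lemma 9.3.11, PREPRINT, at the generic datum); 2m′ = «at every pinned anchor,
from one carried pinned-served class `γ₁` a SECOND carried pinned-served class `γ₂` with `𝔖^pin ⊆ ℂγ₁ + ℂγ₂ + ℂθ³`» (the mover: at `d = 4`,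
`(ḡ_u)_*𝓔̄`, `u = 2+φ₄`, admissible iff `𝓔̄` is — THEOREM T of memo `L1PP-b03x-g7.md`; d-uniform `u = 3+φ_d`). Both hypotheses are OPEN
statements, hypotheses here. [cite: Markman2025SecantWeil, Thm. 1.4.1 (item 4), §1.5 and Lemma 9.3.11] [cite: Bloch1972Semiregularity, Remark (7.5)] -/
theorem anchoredSpanAt_pinned_of_oneCarried_of_secondCarried
    (h₁ : ∀ (Y : SchemeOver ℂ) (θ : complexBetti Y 2), secantQuotientAnchorsPinned Y θ →
      ∃ γ₁ ∈ secantQuotientServedClassesPinned Y θ, γ₁ ∈ carriedClasses 𝒪 6 3 Y θ)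
    (h₂ : ∀ (Y : SchemeOver ℂ) (θ : complexBetti Y 2), secantQuotientAnchorsPinned Y θ →
      ∀ γ₁ ∈ secantQuotientServedClassesPinned Y θ, γ₁ ∈ carriedClasses 𝒪 6 3 Y θ →
        ∃ γ₂ ∈ secantQuotientServedClassesPinned Y θ, γ₂ ∈ carriedClasses 𝒪 6 3 Y θ ∧
          ∀ γ ∈ secantQuotientServedClassesPinned Y θ, ∃ x y z : ℂ, γ = x • γ₁ + y • γ₂ + z • cupPowTwo θ 3) :
    AnchoredSpanAt 𝒪 6 3 (fun Y θ ↦ secantQuotientAnchorsPinned Y θ) (fun Y θ ↦ secantQuotientServedClassesPinned Y θ)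
      (fun Y θ ↦ {w : complexBetti Y (2 * 3) |
        ∃ γ, (γ = 0 ∨ γ ∈ secantQuotientServedClassesPinned Y θ) ∧ ∃ z : ℂ, w = γ + z • cupPowTwo θ 3}) :=
  anchoredSpanAt_pinned_of_two_carried_served fun Y θ hY ↦ by
    obtain ⟨γ₁, hγ₁, hc₁⟩ := h₁ Y θ hY
    obtain ⟨γ₂, hγ₂, hc₂, hspan⟩ := h₂ Y θ hY γ₁ hγ₁ hc₁
    exact ⟨γ₁, hγ₁, γ₂, hγ₂, hc₁, hc₂, hspan⟩

/-- **The ∃-KEYED anchor predicate makes the span statement a THEOREM**: with the anchors SHRUNK to «pinned AND two carried pinned-served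
classes span `𝔖^pin` mod `θ³`» (`𝔄^{pin,2}`), `AnchoredSpanAt 𝒪 6 3 𝔄^{pin,2} 𝔖^pin (𝔖^pin + ℂθ³)` holds outright. Under this keying every
content of the `(6,3)` cell sits in (a) the INHABITATION of `𝔄^{pin,2}` — an ∃-statement over print's construction data, the quantifier shape
of the claim-fact `Markman2025_secantQuotient_twistedCarrier_onJacobian_pinned` (∃ generic datum) plus the mover — and (b) reachability
from `𝔄^{pin,2}`-anchors (stub 2r′'s `¬ AnchorReachableAt` re-domained); nothing is hidden (no such anchor ⇒ the residual is the whole cell).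
[cite: Markman2025SecantWeil, §1.5 (p. 7), Thm. 1.4.1 (item 4) and Lemma 9.3.11] [cite: Bloch1972Semiregularity, Remark (7.5)] -/
theorem anchoredSpanAt_pinnedCarriedPair :
    AnchoredSpanAt 𝒪 6 3
      (fun Y θ ↦ secantQuotientAnchorsPinned Y θ ∧
        ∃ γ₁ ∈ secantQuotientServedClassesPinned Y θ, ∃ γ₂ ∈ secantQuotientServedClassesPinned Y θ,
          γ₁ ∈ carriedClasses 𝒪 6 3 Y θ ∧ γ₂ ∈ carriedClasses 𝒪 6 3 Y θ ∧
          ∀ γ ∈ secantQuotientServedClassesPinned Y θ, ∃ x y z : ℂ, γ = x • γ₁ + y • γ₂ + z • cupPowTwo θ 3)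
      (fun Y θ ↦ secantQuotientServedClassesPinned Y θ)
      (fun Y θ ↦ {w : complexBetti Y (2 * 3) |
        ∃ γ, (γ = 0 ∨ γ ∈ secantQuotientServedClassesPinned Y θ) ∧ ∃ z : ℂ, w = γ + z • cupPowTwo θ 3}) :=
  anchoredSpanAt_served_of_two_carried_served fun _ _ hY ↦ hY.2

/-- **ONE carried pinned-served class per pinned anchor serves the ONE-DIRECTION span** `𝔏₀ Y θ := ℂγ-lines of carried classes + ℂθ³`:
the F7 fallback 2s′₀ («print's `𝓔̄` alone») in kernel form — `AnchoredSpanAt 𝒪 6 3 𝔄^pin 𝔖^pin {x•γ + z•θ³ : γ ∈ 𝔖^pin carried}` holds outright.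
[cite: Markman2025SecantWeil, Thm. 1.4.1 and Lemma 9.3.11] [cite: Bloch1972Semiregularity, Remark (7.5)] -/
theorem anchoredSpanAt_pinned_carriedLine :
    AnchoredSpanAt 𝒪 6 3 (fun Y θ ↦ secantQuotientAnchorsPinned Y θ) (fun Y θ ↦ secantQuotientServedClassesPinned Y θ)
      (fun Y θ ↦ {w : complexBetti Y (2 * 3) | ∃ γ ∈ secantQuotientServedClassesPinned Y θ,
        γ ∈ carriedClasses 𝒪 6 3 Y θ ∧ ∃ x z : ℂ, w = x • γ + z • cupPowTwo θ 3}) :=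
  anchoredSpanAt_of_one_carried fun Y θ _ w hw _ ↦ by
    obtain ⟨γ, hγ, hc, x, z, hw'⟩ := hw
    exact ⟨γ, hγ, IsSecantQuotientWeilClassAtPinned.isRationalClass hγ, hc, x, z, hw'⟩

end Pinned

/-! ## §3 At the road's primed twisted door `tw C AdmTw′` (the literal door of the registered stubs of skeleton v3.5.1) -/

section TwPrime

/-- **F7 re-cut at the primed twisted door**: 2a′₀ ∧ 2m′ ⟹ the registered span stub 2s′ `stub_anchoredSpan_63_secantQuotientPinnedPrime`'s
statement at `C`, door `twistedReflexiveClass C (gluableSigmaAdmissible ∨ bfSingleAdmissible')` spelled out.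
[cite: Markman2025SecantWeil, Thm. 1.4.1 (item 4), §1.5 and Lemma 9.3.11] [cite: Bloch1972Semiregularity, Remark (7.5)] -/
theorem anchoredSpanAt_pinned_twPrime_of_oneCarried_of_secondCarried (C : ChernCharacterBetti)
    (h₁ : ∀ (Y : SchemeOver ℂ) (θ : complexBetti Y 2), secantQuotientAnchorsPinned Y θ →
      ∃ γ₁ ∈ secantQuotientServedClassesPinned Y θ,
        γ₁ ∈ carriedClasses (twistedReflexiveClass C (fun n X₀ I E => Summit.Ventures.HSemireg.gluableSigmaAdmissible n X₀ I E ∨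
          bfSingleAdmissible' n X₀ I E)) 6 3 Y θ)
    (h₂ : ∀ (Y : SchemeOver ℂ) (θ : complexBetti Y 2), secantQuotientAnchorsPinned Y θ →
      ∀ γ₁ ∈ secantQuotientServedClassesPinned Y θ,
        γ₁ ∈ carriedClasses (twistedReflexiveClass C (fun n X₀ I E => Summit.Ventures.HSemireg.gluableSigmaAdmissible n X₀ I E ∨
          bfSingleAdmissible' n X₀ I E)) 6 3 Y θ →
        ∃ γ₂ ∈ secantQuotientServedClassesPinned Y θ,
          γ₂ ∈ carriedClasses (twistedReflexiveClass C (fun n X₀ I E => Summit.Ventures.HSemireg.gluableSigmaAdmissible n X₀ I E ∨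
            bfSingleAdmissible' n X₀ I E)) 6 3 Y θ ∧
          ∀ γ ∈ secantQuotientServedClassesPinned Y θ, ∃ x y z : ℂ, γ = x • γ₁ + y • γ₂ + z • cupPowTwo θ 3) :
    AnchoredSpanAt (twistedReflexiveClass C (fun n X₀ I E => Summit.Ventures.HSemireg.gluableSigmaAdmissible n X₀ I E ∨
        bfSingleAdmissible' n X₀ I E)) 6 3
      (fun Y θ ↦ secantQuotientAnchorsPinned Y θ) (fun Y θ ↦ secantQuotientServedClassesPinned Y θ)
      (fun Y θ ↦ {w : complexBetti Y (2 * 3) |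
        ∃ γ, (γ = 0 ∨ γ ∈ secantQuotientServedClassesPinned Y θ) ∧ ∃ z : ℂ, w = γ + z • cupPowTwo θ 3}) :=
  anchoredSpanAt_pinned_of_oneCarried_of_secondCarried h₁ h₂

/-- **∃-keyed form at the primed twisted door**: the span statement for the shrunk anchor predicate `𝔄^{pin,2}` holds outright.
[cite: Markman2025SecantWeil, §1.5 (p. 7) and Thm. 1.4.1 (item 4)] [cite: Bloch1972Semiregularity, Remark (7.5)] -/
theorem anchoredSpanAt_pinnedCarriedPair_twPrime (C : ChernCharacterBetti) :
    AnchoredSpanAt (twistedReflexiveClass C (fun n X₀ I E => Summit.Ventures.HSemireg.gluableSigmaAdmissible n X₀ I E ∨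
        bfSingleAdmissible' n X₀ I E)) 6 3
      (fun Y θ ↦ secantQuotientAnchorsPinned Y θ ∧
        ∃ γ₁ ∈ secantQuotientServedClassesPinned Y θ, ∃ γ₂ ∈ secantQuotientServedClassesPinned Y θ,
          γ₁ ∈ carriedClasses (twistedReflexiveClass C (fun n X₀ I E => Summit.Ventures.HSemireg.gluableSigmaAdmissible n X₀ I E ∨
            bfSingleAdmissible' n X₀ I E)) 6 3 Y θ ∧
          γ₂ ∈ carriedClasses (twistedReflexiveClass C (fun n X₀ I E => Summit.Ventures.HSemireg.gluableSigmaAdmissible n X₀ I E ∨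
            bfSingleAdmissible' n X₀ I E)) 6 3 Y θ ∧
          ∀ γ ∈ secantQuotientServedClassesPinned Y θ, ∃ x y z : ℂ, γ = x • γ₁ + y • γ₂ + z • cupPowTwo θ 3)
      (fun Y θ ↦ secantQuotientServedClassesPinned Y θ)
      (fun Y θ ↦ {w : complexBetti Y (2 * 3) |
        ∃ γ, (γ = 0 ∨ γ ∈ secantQuotientServedClassesPinned Y θ) ∧ ∃ z : ℂ, w = γ + z • cupPowTwo θ 3}) :=
  anchoredSpanAt_pinnedCarriedPair

end TwPrime

end Summit.HodgeConjecture.HodgeConjecture.Ring2.SemiregularRepresentatives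

end
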